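import Mathlib
import HarnessLib
import HarnessLib.Audit
import Summits.CriticalPhenomena.Statement
import Literature.Probability.RandomPlanarGeometry.SLEConvergenceCriterion
import Literature.Probability.RandomPlanarGeometry.CurveTortuosity
import Literature.Probability.RandomPlanarGeometry.LoopWinding
import Summits.CriticalPhenomena.SAWScalingLimit.Theorems.SAWLeftRightFKGTraversalBoundTight
import HarnessLib.Audit.Status.Attr

/-!
Route: SAWTargetMonotonicity

DORMANT since 2026-08-26T04:22:21Z (reconciler: no traction for 8.3 d (last activity item-evidence-added at 2026-08-17T19:24:59Z); parked, not closed — `ledger route dormant route-CriticalPhenomena-SAWTargetMonotonicity --off` to reacti) — unstaffed, not closed; items shared with open routes are served there. `ledger route dormant <id> --off` reactivates.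

# Route SAWTargetMonotonicity — the polymer aims — target/domain monotone couplings of the critical
SAW chord as an FKG substitute feeding one-curve RSW and an endpoint squeeze

It suffices to show X_TM = (TM) ∧ (DM) ∧ (TM ⇒ DM ⇒ AB) ∧ (I), realising idea card
polymer-aims-target-monotonicity
("the polymer aims"). (TM) TargetMonotone: at x = x_c the critical square-lattice SAW chord law
(Literature.Probability.RandomPlanarGeometry.SAW.law) in a simply connected lattice domain Ω =
{wind(C) ≠ 0} ∩ D (C = P·Q·R a
counter-clockwise closed lattice walk made of three vertex-simple arcs, D any Jordan domain) is
STOCHASTICALLY MONOTONE IN ITS TARGET: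
if the targets b, c sit (in this ccw order after the source a) on ∂Ω, then for every set A of chords
a→b,
law_{a,b}(A) ≤ law_{a,c}{γ′ : ∃ γ ∈ A, γ′ lies weakly beyond γ} (Strassen/Hall form of a left–right
monotone coupling; "weakly beyond" =
the loop γ·(b,b*)·Q·(c*,c)·γ′⁻¹ has winding ≥ 0 everywhere); by exact reversal the same holds in the
source. (DM) DomainMonotone:
removing room on one side of (Ω; a, b) pushes the chord stochastically toward the other side (same
order). (TM ⇒ DM ⇒ AB) MonotoneRSW:
the two couplings replace FKG in a comparison-with-symmetric-situations Russo–Seymour–Welsh scheme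
whose output is the Aizenman–Burchard
hypothesis H1 for the critical SAW (support SAWTraversalBound, shared with route SAWLeftRightFKG).
(I) SubseqIdentification (shared
item stmt-CriticalPhenomena-0783): subsequential limits are chordal SLE_{8/3}. Then the tree's
PROVED Aizenman–Burchard criterion and
Prokhorov principle give the conjunct. Second deliverable (filed informally at open, card U1′):
EndpointSqueeze — TM sandwiches the law
toward any boundary target approximation b_δ between the laws toward fixed neighbouring targets,
reducing the ∀-IsEndpointApprox clause
for boundary targets to ONE approximation per marked point plus continuity of SLE_{8/3} in its
target.
Lean: `TargetMonotone ∧ DomainMonotone ∧ MonotoneRSW ∧ SubseqIdentification` (decls of this route;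
MonotoneRSW ↔ (TargetMonotone → DomainMonotone → SAWTraversalBound) by Iff.rfl; Assembly below)

## Assembly
Pure logic plus the tree's proved reductions, exactly as in route SAWLeftRightFKG: h₃ h₁ h₂ :
SAWTraversalBound (MonotoneRSW's
conclusion is SAWTraversalBound by Iff.rfl), h₄ gives EventualTight; for each (D, a, b) with
IsEndpointApprox the laws SAW.law are
probability measures for all small δ (IsEndpointApprox.reachable ⇒ weight univ ≠ 0; finitely many
SAWs in bounded Ω_δ ⇒ ≠ ∞), so
replace law by a probability-valued family agreeing eventually (ConvergesInLawToSLE,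
IsTightAlongMesh and IsSubseqLimitLaw only see the
germ at 0⁺), apply
Literature.Probability.RandomPlanarGeometry.convergesInLawToSLE_of_isTightAlongMesh with huniq :=
IsSLECurve.map_eq_holds (PROVED), hY := eventually SAW.aemeasurable_curve, hT := EventualTight, hL
:= SubseqIdentification read through
IsSubseqLimitLaw, and unfold SAWScalingLimit =
Literature.Probability.RandomPlanarGeometry.SAW.SAWScalingLimit.

Rationale: WHY THIS LINE. The critical SAW has "no FKG, no Markov property, no RSW" (MadrasSlade1993 Notes to
§4.1; KemppainenSmirnov2017 §4 verifies Condition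
G2 only where FKG holds), which is why every route of this sub-problem stalls on precompactness and
on the endpoint quantifier. The card
observes that the WEAKEST monotonicity a directed polymer could have — aim further along the
boundary, go further (TM); remove room on
one side, move to the other (DM) — holds with zero violations in every enumerated
critical/subcritical instance and fails in the dense
phase, exactly like the conjectured limit: chordal SLE_κ toward x is SLE_κ(κ−6) with force point x
(SchrammWilson2005 Thm 3) whose
drift is monotone in x, cf. flow-line monotonicity MillerSheffield2016 Thm 1.5, and one-sided
restriction with Werner's excursion-cloud
Harris inequality (LawlerSchrammWerner2003Restriction, arXiv:math/0307353 Thm 8). Imported area: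
stochastic order and monotone
couplings (Strassen1965, Holley1974, Harris1960; Karlin1968 MLR kernels as the one-step engine
behind the card's TP₂ generator) and
the association ⇒ RSW ⇒ precompactness technology (KemppainenSmirnov2017, AizenmanBurchardDuke1999,
KohlerSchindlerTassion2023).
What it does that route SAWLeftRightFKG does not: it needs only couplings BETWEEN measures with
different marked points/domains (PA of
one measure implies DM — support FKGGivesDomainMonotone — but is not needed), it types the
cross-endpoint statement TM that no
association statement provides, and TM alone yields the endpoint squeeze; the negatives index
(stmt-CriticalPhenomena-0772) is
respected: only eventual tightness appears.

RANKED CRUXES. #2 TargetMonotone (crux) — THE POLYMER AIMS (card M1), Strassen/Hall form at x = x_c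
on δℤ². Data: D a Jordan domain, δ > 0, lattice paths P : a*→b*, Q : b*→c*, R : c*→a*
(vertex-simple, junction vertices not revisited) with C := P·Q·R counter-clockwise (wind C ∈ {0,1}
everywhere), Ω := {z : wind(C, z) ≠ 0} ∩ D.carrier; the source a and the targets b, c are the
lattice points to the LEFT of (or straight behind: slit tips, reflex corners) the first darts of P,
Q, R (so a, b, c are met in this ccw order), a ≠ b ≠ c ≠ a, and a is joined to b and to c in Ω_δ.
Claim: for every set A of SAW chords a→b of Ω_δ, SAW.law Ω δ a b A ≤ SAW.law Ω δ a c {γ′ | ∃ γ ∈ A,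
∀ z, 0 ≤ wind(γ · (b,b*) · Q · (c*,c) · γ′⁻¹, z)}, i.e. (finite Strassen theorem) γ ~ law_{a,b} and
γ′ ~ law_{a,c} can be coupled so that the region between γ and the arc P is contained in the region
between γ′ and P∪Q. Evidence (card): the one-point form has 0 violations over all (a,b,z) at x ∈
{0.25, x_c, 0.42, 0.45, 0.47} on 4×4…6×5 boxes and fails for x ≥ 0.5; continuum shadow: SLE_κ toward
x = SLE_κ(κ−6) forced at x (SchrammWilson2005 Thm 3), drift (κ−6)/(W−x) monotone in x ⇒ synchronous
coupling orders the curves for κ ≤ 4. Head-left attachments and removal on the P-side follow by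
mirror + reversal (prover-side lemmas). [difficulty: XL] (why it might fail: Only 1-point marginals
on ≤6×5 boxes support it; Strassen needs ALL increasing events; the finite-size onset (x≈0.47–0.5)
may sink below x_c≈0.379 on large or fjorded domains; no FKG/TP₂ for SAW is known (MadrasSlade1993
§4.1 notes).) [Summits/CriticalPhenomena/SAWScalingLimit/Ideas/polymer-aims-target-monotonicity.md,
SchrammWilson2005, MillerSheffield2016, Strassen1965, Karlin1968, Fomin2001, MadrasSlade1993,
DuminilCopinKozmaYadin2014]
#3 DomainMonotone (crux) — DOMAIN MONOTONICITY (card M2): same conventions with two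
counter-clockwise boundaries C = P·R and C′ = P·R′ sharing the arc P : a*→b* (R, R′ : b*→a*
vertex-simple), Ω′ := {wind C′ ≠ 0} ∩ D.carrier ⊆ Ω := {wind C ≠ 0} ∩ D.carrier (room removed on the
R-side only: hulls and slits attached to the arc R), a and b the lattice points to the left of (or
straight behind) the first darts of P and of R, R′, a ≠ b joined in both Ω_δ and Ω′_δ. Claim: for
every set A of chords of Ω′_δ, SAW.law Ω′ δ a b A ≤ SAW.law Ω δ a b {γ | ∃ γ′ ∈ A, ∀ z, 0 ≤
wind(γ′·γ⁻¹, z)} — removing room on one side pushes the chord, in the left–right order of route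
SAWLeftRightFKG (same lens-loop winding), stochastically toward the other side. A consequence of
positive association (support FKGGivesDomainMonotone: {γ ⊆ Ω′} is a down-set); continuum shadow:
one-sided restriction of SLE_{8/3} (LawlerSchrammWerner2003Restriction) + Harris inequality for the
one-sided excursion cloud (arXiv:math/0307353 Thm 8). [difficulty: XL] (why it might fail:
Equivalent to negative correlation of the down-set {γ ⊆ Ω′} with every up-set — an FKG-type
inequality on a non-distributive chord poset; supported numerically near x_c on small Z² boxes only
(cards avoidance-fkg-z2-pockets, fkg-z2-threshold-evidence) and false as x→1.)
[LawlerSchrammWerner2003Restriction, arXiv:math/0307353, Holley1974, FortuinKasteleynGinibre1971,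
Summits/CriticalPhenomena/SAWScalingLimit/Ideas/hex-saw-leftright-fkg.md,
stmt-CriticalPhenomena-1877]
#4 MonotoneRSW (crux) — the FKG-FREE ONE-CURVE RSW ENGINE (card U3′) as the implication
TargetMonotone → DomainMonotone → (Aizenman–Burchard hypothesis H1 for the critical SAW; conclusion
= support SAWTraversalBound verbatim, Iff.rfl): for every Dobrushin domain and endpoint
approximation there are a shell-dependent threshold k(x,ρ,R), K, λ > 2, δ₀ with P_δ[k(x,ρ,R)
separate traversals of D(x;ρ,R)] ≤ K(ρ/R)^λ for δ ≤ δ₀, δ ≤ ρ < R ≤ 1. Scheme: (i) domain Markov —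
after the j-th traversal the future is an x_c-SAW from the tip in the domain slit by the past, which
is the typed setting of TM/DM with the slit tip as the junction a*; (ii) TM moves the target (and,
by exact reversal law(b→a) = reverse∗law(a→b), the source) to a position symmetric with respect to
the sector to be crossed, DM trades the slit domain for a reflection-symmetric comparison domain at
the price of conditioning on a monotone event; (iii) the reflection exchanges 'cross' and 'not
cross', pinning the unforced crossing probability at ≤ 1/2 uniformly in δ (lattice-scale input:
Kesten's bridge-mass bound Σ_T a_T ≤ 1 at x_c, MadrasSlade1993 (4.2.4)); (iv) iterate over
traversals for λ(k) → ∞ with forced crossings near a, b and fjords absorbed into k(x,ρ,R) as in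
Literature.Probability.Percolation.bondExploration_traversalBound; interior starting points by
conditioning on the walk up to its last exit from a mesoscopic ball around the marked point. [deps:
TargetMonotone, DomainMonotone] [difficulty: XL] (why it might fail: Needs at every scale, also near
a, b, a comparison domain with a reflection exchanging cross/not-cross while TM/DM control both
replacements; for interior starts (allowed by IsEndpointApprox) the past is a floating slit, Ω∖past
is doubly connected and the typed TM/DM do not apply.) [KemppainenSmirnov2017,
AizenmanBurchardDuke1999, KohlerSchindlerTassion2023, Kesten1963SAW, MadrasSlade1993,
DuminilCopinHammond2013, arXiv:2310.17299,
Literature.Probability.Percolation.bondExploration_traversalBound]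
#5 SubseqIdentification (crux) — identification of subsequential limits (shared verbatim with routes
SAWParafermion / SAWLeftRightFKG, item stmt-CriticalPhenomena-0783): for every Dobrushin domain,
endpoint approximation, mesh sequence s_n → 0⁺ and probability measure μ on CurveClass ℂ, if ∫
f∘curve d(SAW.law …(s n)…) → ∫ f dμ for all bounded continuous f then μ is the chordal SLE_{8/3} law
of D (Literature.Probability.RandomPlanarGeometry.IsSLELaw (8/3) D μ). NOT this route's mechanism
(monotone couplings are embedding-blind); staffed through the identification routes; EndpointSqueeze
(rank 6, informal) reduces what they must prove for boundary targets to one approximation per marked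
point. [difficulty: open-problem] (why it might fail: Unconditional over arbitrary subsequential μ:
SLE_{8/3} is known only IF the limit is conformally covariant (LSW04 Prediction 1); on Z² no
embedding-sensitive input exists; embedding-blind couplings cannot give rotations (Beffara2008).)
[LawlerSchrammWerner2004SAW, LawlerSchrammWerner2003Restriction, DuminilCopinSmirnov2012,
Beffara2008, stmt-CriticalPhenomena-0783]
#9 SAWTraversalBound (support) — the Aizenman–Burchard hypothesis (H1) for the critical
square-lattice SAW, standalone (shared verbatim with route SAWLeftRightFKG, item
stmt-CriticalPhenomena-1880; = the conclusion of MonotoneRSW): for every Dobrushin domain D and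
endpoint approximation there are k : ℂ → ℝ → ℝ → ℕ, K ≥ 0, λ > 2, δ₀ > 0 with SAW.law D δ a_δ b_δ {γ
: the mesh polyline of γ has k(x,ρ,R) separate traversals of D(x;ρ,R)} ≤ K(ρ/R)^λ for δ ∈ (0,δ₀], δ
≤ ρ < R ≤ 1 (Literature.Probability.RandomPlanarGeometry.Curve.HasTraversals; shape of the PROVED
Literature.Probability.Percolation.bondExploration_traversalBound). [difficulty: open-problem]
[AizenmanBurchardDuke1999, KemppainenSmirnov2017, DuminilCopinHammond2013, arXiv:2310.17299,
stmt-CriticalPhenomena-1880]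
#9 EventualTight (support) — EVENTUAL tightness of the critical SAW laws (shared verbatim with route
SAWLeftRightFKG, item stmt-CriticalPhenomena-1881; the repaired form of the refuted all-δ Tight
stmt-CriticalPhenomena-0772): for every Dobrushin domain and endpoint approximation,
IsTightAlongMesh (fun δ γ => γ.curve) (fun δ => SAW.law D δ a_δ b_δ). [difficulty: open-problem]
[Summit.CriticalPhenomena.SAWScalingLimit.Theorems.SAWParafermionTight_refuted,
AizenmanBurchardDuke1999, KemppainenSmirnov2017, stmt-CriticalPhenomena-1881]
#9 TraversalBoundTight (support) — glue SAWTraversalBound → EventualTight by the tree's PROVED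
Aizenman–Burchard criterion
Literature.Probability.RandomPlanarGeometry.isTightMeasureSet_of_traversalBounds (E = ℂ, Λ a closed
ball containing D, T = Ioc 0 δ₀, short-distance cutoff (H0) because a SAW uses each lattice edge
once) and the bridge isTightAlongMesh_of_isTightMeasureSet_image (a.e.-measurability automatic:
SAW.aemeasurable_curve). Shared verbatim with route SAWLeftRightFKG (stmt-CriticalPhenomena-1882).
[difficulty: provable-now]
[Literature.Probability.RandomPlanarGeometry.isTightMeasureSet_of_traversalBounds,
Literature.Probability.RandomPlanarGeometry.isTightAlongMesh_of_isTightMeasureSet_image,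
AizenmanBurchardDuke1999, stmt-CriticalPhenomena-1882]
#9 FKGGivesDomainMonotone (support) — positive association implies domain monotonicity: the
hypothesis is the body of LeftRightFKG of route SAWLeftRightFKG (item stmt-CriticalPhenomena-1877)
verbatim — w(A)w(B) ≤ w(univ)w(A∩B) for up-sets A, B of chords of Ω = {wind C ≠ 0} in the
lens-winding order — and the conclusion is DomainMonotone. Proof plan: law_{Ω′} = law_Ω(· | E) with
E = {γ uses only vertices/edges of Ω′_δ} (same weights x_c^{|γ|}); E is a DOWN-set for the order (if
γ₁ ≼ γ₂ and γ₂ avoids the removed set, so does γ₁ — planar argument with the winding regions); PA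
gives law(U ∩ E) ≤ law(U)·law(E) for every up-set U, hence law(U | E) ≤ law(U), and the up-closure
of the image of A is such a U; the ∩ D.carrier bites are handled by applying PA in Ω′-type winding
domains or recorded as a gap (the polygon case D ⊇ hull(C) is the core). [difficulty: M]
[FortuinKasteleynGinibre1971, Holley1974, Strassen1965, stmt-CriticalPhenomena-1877]

TWO-LAYER PLAN. Foreseen glued splits (nothing filed now): TargetMonotone ⇐ KernelTP2 (2×2 minors of
the boundary two-point kernel x_c·K_{Ω∖a}(u,·)
in cyclic order on every domain of the typed class — the conjecture of card totally-positive-polymer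
restricted to boundary minors) →
KernelToTarget (one-step MLR in the target, Karlin1968, integrated along the domain-Markov
exploration with DomainMonotone keeping the
order after the coupled walks split; card M3) → TargetMonotone. MonotoneRSW ⇐ OneSectorBound
(TM+DM+reflection ⇒ unforced sector
crossing ≤ 1−ε uniformly: Kemppainen–Smirnov Condition G2 for the SAW family, to be typed over
Literature.Probability.RandomPlanarGeometry.ConditionG2) → G2ToTraversalBound (domain-Markov
iteration, λ(k) → ∞) → MonotoneRSW.
EndpointSqueeze (rank 6, informal at open) ⇐ LatticeToLimitOrder (TM passes to subsequential limits
as a.s. nesting of side regions,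
windings are stable off the traces) → SLESqueeze (a probability law on simple chords of (D;a,b) that
is left–right sandwiched between
SLE_{8/3}(D;a,b⁻) and SLE_{8/3}(D;a,b⁺) for all b⁻ → b ← b⁺ is SLE_{8/3}(D;a,b): Choquet capacities
of the two side regions are
increasing functionals, and SLE in the target is continuous via 3-point-normalised automorphisms of
D̄).

KILL CRITERIA. ¬TargetMonotone certified at x_c (an LP-infeasible monotone transport between
law_{a,b} and law_{a,c} in some lattice domain of the
typed class, μ ∈ [2.6, 2.7] making x_c-inequalities decidable by interval arithmetic) closes the
route — close --reason
refuted:TargetMonotone — unless the witness lives at a junction/attachment degeneracy of the typing,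
in which case the tenure repair is
a restate with the witness excluded and the informal reading unchanged. ¬DomainMonotone refutes the
engine MonotoneRSW as planned AND
LeftRightFKG of route SAWLeftRightFKG (PA ⇒ DM): pivot to the TM-only deliverables (EndpointSqueeze,
continuity of limit families in
marked points) as a reduced, non-conjunct-facing route or close. ¬SAWTraversalBound (shared) means
eventual tightness fails for some
approximation and refutes the conjunct as typed — report, do not repair. ¬SubseqIdentification kills
the conjunct. LeftRightFKG proved
makes DM a corollary (FKGGivesDomainMonotone) and leaves TM + the engine; SAWTraversalBound or
EventualTight proved elsewhere moots
MonotoneRSW; SAWScalingLimit proved elsewhere moots everything but TM/DM as structural by-products.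

NOT DECOMPOSED YET. The TP₂ generator and the Markovian coupling lemma behind TargetMonotone
(layer-2, see Two-layer plan); the symmetrisation scheme inside
MonotoneRSW (which sectors, which reflection-symmetric comparison domains, where Kesten's bridge
identity supplies ε on ℤ² where
Σ a_T ≤ 1 is not < 1; interior starting points = floating slits); the head-left attachments and
P-side removals (mirror +
reversal lemmas, prover-side via --supports, never items); fugacities x < x_c
(Literature.Barriers.CriticalPhenomena.SupercriticalSAW.weightAt)
and the hexagonal model case; the continuum statements (TM for chordal SLE_κ, κ ≤ 4, by synchronous
coupling of SLE_κ(κ−6) drifts;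
DM for SLE_{8/3} by one-sided restriction) — true but not needed by the assembly; EndpointSqueeze's
typing (it needs a left–right
target order for chords of the mesh domain D_δ of a JORDAN domain, whose boundary is not a lattice
walk — definition request below —
and the simplicity of subsequential limits it consumes); U2 of the card (monotone limit families are
continuous in the marked points
off a countable set).

CHEAPEST FALSIFIER. Exact enumeration at x_c (kit, minutes): in the 4×4, 5×5 and 6×5 boxes and in a
6×6 box with a 3-edge slit whose tip carries the source,
list all chords a→b and a→c for every admissible (a,b,c) and solve the transport LP "∃ coupling
supported on nested pairs" (≈10³×10³
variables; equivalently check Hall's condition on the ≤ 2^{20} down-closed families by max-flow).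
One infeasible instance at x = x_c
kills TargetMonotone (the card only tested the one-point projection; its own 'fastest refutation'
(ii)–(iii) is exactly this); the
same LP with Ω′ = Ω minus one boundary cell tests DomainMonotone. Not run here (hub compute-free for
this unit; recorded for the
refuter, who should also re-run the card's exp/target_mono.py at x = x_c with interval arithmetic).

NUMBERS. μ(ℤ²) ≈ 2.63816, x_c = 1/μ ≈ 0.37905; in tree 2.6 ≤ μ ≤ 2.7
(Literature.Probability.RandomPlanarGeometry.SAW.LawlerSchrammWerner2004SAW_connectiveConstant_bounds).
Card data (one-point
form of TM, next-ccw target): 0 violations over all (a,b,z) at x ∈ {0.25, x_c, 0.42, 0.45, 0.47} on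
4×4, 5×4, 5×5, 6×4, 6×5 boxes
(1920–8640 triples each); violations at x = 0.5 (5×5: 24/5600; 6×4: 16/5376), 35–40 % with margins
−0.2 at x = 0.7 and x = 1.
Association thresholds on ℤ² boxes (route SAWLeftRightFKG): x₀(L) = .53/.486/.462 for L = 3, 4, 5.
Aizenman–Burchard: λ > 2 in
d = 2; KS Condition G2: unforced annulus crossing ≤ 1/2 at some fixed modulus. Continuum: SLE_κ(ρ)
with ρ = κ − 6 = −10/3 at
κ = 8/3; restriction exponent 5/8. Items at open: 9 typed (4 cruxes, 4 support, 1 assembly) +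
EndpointSqueeze informal (rank 6).

DEFINITION REQUESTS. (1) `SAW.IsTargetOrdered` in Literature/Probability/RandomPlanarGeometry (for
EndpointSqueeze): for a Jordan/Dobrushin carrier Ω, mesh
δ, source a and two boundary-layer targets b, c ∈ meshBoundary Ω δ given with exterior neighbours
b*, c* and a lattice-free
connector, the Hall-form left–right order "law Ω δ a b ≼ law Ω δ a c" with side regions cut out by
the DISCRETE boundary of Ω_δ
rather than by a lattice polygon — so that TargetMonotone (polygon ∩ Jordan typing) can be
transported to SAW.law D.carrier and the
squeeze stated over SAW.IsEndpointApprox. (2) No cite facts needed: Strassen's finite coupling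
theorem is avoided by the Hall form;
KS17 Thm 1.5 is not in the assembly (AB criterion is proved in tree).

Novelty: Searches (2026-08-15): `lit galaxy search "stochastic domination self-avoiding walk" --star all`
(0/0/0); `lit galaxy search --star pdf
--mode bm25 "law of a SAW/polymer chord stochastically monotone in its target, monotone coupling,
FKG substitute"` (12: Oberwolfach
report 27/2007, KPZ/extreme-value reviews — none on point); `lit search --source zbmath
"self-avoiding walk monotone"` (1: Liu 2024
arXiv:2210.15580, escape speed of WSAW on ℤ — unrelated), zbmath "self-avoiding walk stochastic
monotonicity coupling" (0), zbmath
"monotone coupling interface boundary conditions Strassen stochastic order lattice" (0); `--source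
crossref "self-avoiding walk
correlation inequality FKG"` (10: MadrasSlade1993 chapters only), crossref "monotonicity chordal SLE
target point stochastic domination"
(10: Zhan Green's functions/reversibility — none); `lit frontier CriticalPhenomena --since 2021` (30
rows; SAW: arXiv:2310.17299
only), `lit bridges CriticalPhenomena --cross any` (no SAW bridge); `lit read arXiv:math/0505368`
(Thm 3 verified on p.5); OpenAlex /
S2 / arXiv HTTP 429 this session (the card's novelty audit of 2026-08-15 ran lit hybrid + arXiv +
galaxy with the same null result for
SAW). In-hub: routes SAWLeftRightFKG (PA ⇒ RSW ⇒ AB), SAWCircleScreening (endpoint robustness by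
screening), negatives index (1 item).
Nearest prior art found: monotone couplings of Dobrushin interfaces in boundary conditions for FKG
models (Grimmett2006; Holley1974;
Strassen1965) and Karlin1968 / KarlinM  [refs: 2210.15580, 2310.17299, math/0505368, math/0307353, MadrasSlade1993, Grimmett2006, Holley1974, Strassen1965, Karlin1968, KarlinMcgregor1959, Fomin2001, SchrammWilson2005, MillerSheffield2016, KemppainenSmirnov2017, KohlerSchindlerTassion2023, AizenmanBurchardDuke1999]

Barriers (technique_class: monotone-coupling correlation-inequality one-curve-rsw): - technique_class: monotone-coupling correlation-inequality one-curve-rsw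
- Literature.Barriers.CriticalPhenomena.SAWNotKineticallyGrown: evaded — every statement is about
the configurational x_c^{|γ|} law SAW.law and its EXACT domain-Markov conditioning (ratios of
partition functions); no growth rule, no consistent kinetic family, no locality/κ = 6 object.
- Literature.Barriers.CriticalPhenomena.SupercriticalSAWSpaceFilling: respected as a guard — TM/DM
are claimed at x = x_c only (SAW.law) and the card OBSERVES TM failing for x ≥ 0.5; nothing is an
open condition in x, RobustSAWScalingLimit is not entailed.
- Literature.Barriers.CriticalPhenomena.EmbeddingModulusUniqueness: it does not evade it and does
not try — monotone couplings are affine/embedding-blind; the bet is precompactness (EventualTight) +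
endpoint squeeze only, with identification imported through SubseqIdentification from
embedding-sensitive routes.
- Literature.Barriers.CriticalPhenomena.NienhuisWeightsExcludeVertexSAW: does not apply — no
observable, no local linear relation, vertex SAW weights throughout.
- Literature.Barriers.CriticalPhenomena.ParafermionicHalfCauchyRiemann: does not apply — no discrete
holomorphicity is used.
- Literature.Barriers.CriticalPhenomena.SAWNoUnitaryCFT: does not apply — no Hilbert-space
positivity; the positivity used is order-theoretic (stochastic order), cf. card
saw-not-reflection-positive.
- Literature.Barriers.CriticalPhenomena.TransverseCrossingsNeedNotMeet: planar-only

History (route lifecycle, newest last):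
- 2026-08-26T04:22:21Z · DORMANT — reconciler: no traction for 8.3 d (last activity item-evidence-added at 2026-08-17T19:24:59Z); parked, not closed — `ledger route dormant route-CriticalPhenomen (operator:999:2331173)

sub-problem: SAWScalingLimit · status: dormant · opened planner-plancard-CriticalPhenomena-SAWScaling-d9d1a643-0 2026-08-15T12:35:53Z · rev 1 · ledger route-CriticalPhenomena-SAWTargetMonotonicity
GENERATED by the gate from the ledger (D-0016/17). Provers cite these decls: `theorem foo : Summit.CriticalPhenomena.SAWScalingLimit.Theses.SAWTargetMonotonicity.<Decl> := …` in Summits/CriticalPhenomena/SAWScalingLimit/Theorems/<Name>.lean.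
-/

namespace Summit.CriticalPhenomena.SAWScalingLimit.Theses.SAWTargetMonotonicity

open scoped BigOperators Topology Manifold Classical MeasureTheory ProbabilityTheory Matrix InnerProductSpace ComplexConjugate ContinuousMap
open Filter Set Function TopologicalSpace MeasureTheory

attribute [summit_statement] _root_.SAWScalingLimit

/-- item stmt-CriticalPhenomena-8253 · crux · rank 2 · open · by planner
why it might fail: Only 1-point marginals on ≤6×5 boxes support it; Strassen needs ALL increasing events; the finite-size onset (x≈0.47–0.5) may sink below x_c≈0.379 on large or fjorded domains; no FKG/TP₂ for SAW is known (MadrasSlade1993 §4.1 notes).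
sources: Summits/CriticalPhenomena/SAWScalingLimit/Ideas/polymer-aims-target-monotonicity.md, SchrammWilson2005, MillerSheffield2016, Strassen1965, Karlin1968, Fomin2001
[crux] THE POLYMER AIMS (card M1), Strassen/Hall form at x = x_c on δℤ². Data: D a Jordan domain, δ
> 0, lattice paths P : a*→b*, Q : b*→c*, R : c*→a* (vertex-simple, junction vertices not revisited)
with C := P·Q·R counter-clockwise (wind C ∈ {0,1} everywhere), Ω := {z : wind(C, z) ≠ 0} ∩
D.carrier; the source a and the targets b, c are the lattice points to the LEFT of (or straight
behind: slit tips, reflex corners) the first darts of P, Q, R (so a, b, c are met in this ccw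
order), a ≠ b ≠ c ≠ a, and a is joined to b and to c in Ω_δ. Claim: for every set A of SAW chords
a→b of Ω_δ, SAW.law Ω δ a b A ≤ SAW.law Ω δ a c {γ′ | ∃ γ ∈ A, ∀ z, 0 ≤ wind(γ · (b,b*) · Q · (c*,c)
· γ′⁻¹, z)}, i.e. (finite Strassen theorem) γ ~ law_{a,b} and γ′ ~ law_{a,c} can be coupled so that
the region between γ and the arc P is contained in the region between γ′ and P∪Q. Evidence (card):
the one-point form has 0 violations over all (a,b,z) at x ∈ {0.25, x_c, 0.42, 0.45, 0.47} on 4×4…6×5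
boxes and fails for x ≥ 0.5; continuum shadow: SLE_κ toward x = SLE_κ(κ−6) forced at x
(SchrammWilson2005 Thm 3), drift (κ−6)/(W−x) monotone in x ⇒ synchronous coupling orders the curves
for κ ≤ 4. Head-left attachments -/
@[route_item "route-CriticalPhenomena-SAWTargetMonotonicity", crux]
def TargetMonotone : Prop :=
  ∀ (D : Literature.Probability.RandomPlanarGeometry.JordanDomain) (δ : ℝ) (a' b' c' a b c : Literature.Probability.LatticeModels.Site 2) (P : (Literature.Probability.LatticeModels.zdGraph 2).Walk a' b') (Q : (Literature.Probability.LatticeModels.zdGraph 2).Walk b' c') (R : (Literature.Probability.LatticeModels.zdGraph 2).Walk c' a') (hb : (Literature.Probability.LatticeModels.zdGraph 2).Adj b b') (hc : (Literature.Probability.LatticeModels.zdGraph 2).Adj c' c), let C := P.append (Q.append R); let Ω : Set ℂ := {z | Literature.Probability.RandomPlanarGeometry.Curve.wind ⟨C.toCurve (Literature.Probability.LatticeModels.meshPoint δ)⟩ z ≠ 0} ∩ D.carrier; let hle : Literature.Probability.LatticeModels.discreteDomainGraph Ω δ ≤ Literature.Probability.LatticeModels.zdGraph 2 := (Literature.Probability.LatticeModels.discreteDomainGraph_le_meshGraph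 Ω δ).trans (Literature.Probability.LatticeModels.meshGraph_le_zdGraph Ω δ); let lft : Literature.Probability.LatticeModels.Site 2 → Literature.Probability.LatticeModels.Site 2 → Literature.Probability.LatticeModels.Site 2 := fun u v => u + ![-(v 1 - u 1), v 0 - u 0]; 0 < δ → P.IsPath → Q.IsPath → R.IsPath → a' ∉ Q.support → b' ∉ R.support → c' ∉ P.support → (∀ z : ℂ, Literature.Probability.RandomPlanarGeometry.Curve.wind ⟨C.toCurve (Literature.Probability.LatticeModels.meshPoint δ)⟩ z = 0 ∨ Literature.Probability.RandomPlanarGeometry.Curve.wind ⟨C.toCurve (Literature.Probability.LatticeModels.meshPoint δ)⟩ z = 1) → (a = lft a' (P.getVert 1) ∨ a = a' + (a' - P.getVert 1)) → (b = lft b' (Q.getVert 1) ∨ b = b' + (b' - Q.getVert 1)) → (c = lft c' (R.getVert 1) ∨ c = c' + (c' - R.getVert 1)) → a ≠ b → a ≠ c → b ≠ c → (Literature.Probability.LatticeModels.discreteDomainGraph Ω δ).Reachable a b → (Literature.Probability.LatticeModels.discreteDomainGraph Ω δ).Reachable a c → ∀ A : Set (Literature.Probability.RandomPlanarGeometry.SAW.DomainSAW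 Ω δ a b), Literature.Probability.RandomPlanarGeometry.SAW.law Ω δ a b A ≤ Literature.Probability.RandomPlanarGeometry.SAW.law Ω δ a c {γ' | ∃ γ ∈ A, ∀ z : ℂ, 0 ≤ Literature.Probability.RandomPlanarGeometry.Curve.wind ⟨((γ.walk.mapLe hle).append ((SimpleGraph.Walk.cons hb SimpleGraph.Walk.nil).append (Q.append ((SimpleGraph.Walk.cons hc SimpleGraph.Walk.nil).append (γ'.walk.mapLe hle).reverse)))).toCurve (Literature.Probability.LatticeModels.meshPoint δ)⟩ z}

/-- item stmt-CriticalPhenomena-8254 · crux · rank 3 · open · by planner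
why it might fail: Equivalent to negative correlation of the down-set {γ ⊆ Ω′} with every up-set — an FKG-type inequality on a non-distributive chord poset; supported numerically near x_c on small Z² boxes only (cards avoidance-fkg-z2-pockets, fkg-z2-threshold-evidence) and false as x→1.
sources: LawlerSchrammWerner2003Restriction, arXiv:math/0307353, Holley1974, FortuinKasteleynGinibre1971, Summits/CriticalPhenomena/SAWScalingLimit/Ideas/hex-saw-leftright-fkg.md, stmt-CriticalPhenomena-1877
[crux] DOMAIN MONOTONICITY (card M2): same conventions with two counter-clockwise boundaries C = P·R
and C′ = P·R′ sharing the arc P : a*→b* (R, R′ : b*→a* vertex-simple), Ω′ := {wind C′ ≠ 0} ∩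
D.carrier ⊆ Ω := {wind C ≠ 0} ∩ D.carrier (room removed on the R-side only: hulls and slits attached
to the arc R), a and b the lattice points to the left of (or straight behind) the first darts of P
and of R, R′, a ≠ b joined in both Ω_δ and Ω′_δ. Claim: for every set A of chords of Ω′_δ, SAW.law
Ω′ δ a b A ≤ SAW.law Ω δ a b {γ | ∃ γ′ ∈ A, ∀ z, 0 ≤ wind(γ′·γ⁻¹, z)} — removing room on one side
pushes the chord, in the left–right order of route SAWLeftRightFKG (same lens-loop winding),
stochastically toward the other side. A consequence of positive association (support
FKGGivesDomainMonotone: {γ ⊆ Ω′} is a down-set); continuum shadow: one-sided restriction of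
SLE_{8/3} (LawlerSchrammWerner2003Restriction) + Harris inequality for the one-sided excursion cloud
(arXiv:math/0307353 Thm 8). [difficulty: XL] -/
@[route_item "route-CriticalPhenomena-SAWTargetMonotonicity", crux]
def DomainMonotone : Prop :=
  ∀ (D : Literature.Probability.RandomPlanarGeometry.JordanDomain) (δ : ℝ) (a' b' a b : Literature.Probability.LatticeModels.Site 2) (P : (Literature.Probability.LatticeModels.zdGraph 2).Walk a' b') (R R' : (Literature.Probability.LatticeModels.zdGraph 2).Walk b' a'), let C := P.append R; let C' := P.append R'; let Ω : Set ℂ := {z | Literature.Probability.RandomPlanarGeometry.Curve.wind ⟨C.toCurve (Literature.Probability.LatticeModels.meshPoint δ)⟩ z ≠ 0} ∩ D.carrier; let Ω' : Set ℂ := {z | Literature.Probability.RandomPlanarGeometry.Curve.wind ⟨C'.toCurve (Literature.Probability.LatticeModels.meshPoint δ)⟩ z ≠ 0} ∩ D.carrier; let hle : Literature.Probability.LatticeModels.discreteDomainGraph Ω δ ≤ Literature.Probability.LatticeModels.zdGraph 2 := (Literature.Probability.LatticeModels.discreteDomainGraph_le_meshGraph Ω δ).trans (Literature.Probability.LatticeModels.meshGraph_le_zdGraph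 Ω δ); let hle' : Literature.Probability.LatticeModels.discreteDomainGraph Ω' δ ≤ Literature.Probability.LatticeModels.zdGraph 2 := (Literature.Probability.LatticeModels.discreteDomainGraph_le_meshGraph Ω' δ).trans (Literature.Probability.LatticeModels.meshGraph_le_zdGraph Ω' δ); let lft : Literature.Probability.LatticeModels.Site 2 → Literature.Probability.LatticeModels.Site 2 → Literature.Probability.LatticeModels.Site 2 := fun u v => u + ![-(v 1 - u 1), v 0 - u 0]; 0 < δ → P.IsPath → R.IsPath → R'.IsPath → (∀ z : ℂ, Literature.Probability.RandomPlanarGeometry.Curve.wind ⟨C.toCurve (Literature.Probability.LatticeModels.meshPoint δ)⟩ z = 0 ∨ Literature.Probability.RandomPlanarGeometry.Curve.wind ⟨C.toCurve (Literature.Probability.LatticeModels.meshPoint δ)⟩ z = 1) → (∀ z : ℂ, Literature.Probability.RandomPlanarGeometry.Curve.wind ⟨C'.toCurve (Literature.Probability.LatticeModels.meshPoint δ)⟩ z = 0 ∨ Literature.Probability.RandomPlanarGeometry.Curve.wind ⟨C'.toCurve (Literature.Probability.LatticeModels.meshPoint δ)⟩ z = 1) → Ω' ⊆ Ω → (a =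 lft a' (P.getVert 1) ∨ a = a' + (a' - P.getVert 1)) → (b = lft b' (R.getVert 1) ∨ b = b' + (b' - R.getVert 1)) → (b = lft b' (R'.getVert 1) ∨ b = b' + (b' - R'.getVert 1)) → a ≠ b → (Literature.Probability.LatticeModels.discreteDomainGraph Ω δ).Reachable a b → (Literature.Probability.LatticeModels.discreteDomainGraph Ω' δ).Reachable a b → ∀ A : Set (Literature.Probability.RandomPlanarGeometry.SAW.DomainSAW Ω' δ a b), Literature.Probability.RandomPlanarGeometry.SAW.law Ω' δ a b A ≤ Literature.Probability.RandomPlanarGeometry.SAW.law Ω δ a b {γ | ∃ γ' ∈ A, ∀ z : ℂ, 0 ≤ Literature.Probability.RandomPlanarGeometry.Curve.wind ⟨((γ'.walk.mapLe hle').append (γ.walk.mapLe hle).reverse).toCurve (Literature.Probability.LatticeModels.meshPoint δ)⟩ z}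

/-- item stmt-CriticalPhenomena-8255 · crux · rank 4 · open · by planner
why it might fail: Needs at every scale, also near a, b, a comparison domain with a reflection exchanging cross/not-cross while TM/DM control both replacements; for interior starts (allowed by IsEndpointApprox) the past is a floating slit, Ω∖past is doubly connected and the typed TM/DM do not apply.
sources: KemppainenSmirnov2017, AizenmanBurchardDuke1999, KohlerSchindlerTassion2023, Kesten1963SAW, MadrasSlade1993, DuminilCopinHammond2013
[crux] the FKG-FREE ONE-CURVE RSW ENGINE (card U3′) as the implication TargetMonotone →
DomainMonotone → (Aizenman–Burchard hypothesis H1 for the critical SAW; conclusion = support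
SAWTraversalBound verbatim, Iff.rfl): for every Dobrushin domain and endpoint approximation there
are a shell-dependent threshold k(x,ρ,R), K, λ > 2, δ₀ with P_δ[k(x,ρ,R) separate traversals of
D(x;ρ,R)] ≤ K(ρ/R)^λ for δ ≤ δ₀, δ ≤ ρ < R ≤ 1. Scheme: (i) domain Markov — after the j-th traversal
the future is an x_c-SAW from the tip in the domain slit by the past, which is the typed setting of
TM/DM with the slit tip as the junction a*; (ii) TM moves the target (and, by exact reversal
law(b→a) = reverse∗law(a→b), the source) to a position symmetric with respect to the sector to be
crossed, DM trades the slit domain for a reflection-symmetric comparison domain at the price of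
conditioning on a monotone event; (iii) the reflection exchanges 'cross' and 'not cross', pinning
the unforced crossing probability at ≤ 1/2 uniformly in δ (lattice-scale input: Kesten's bridge-mass
bound Σ_T a_T ≤ 1 at x_c, MadrasSlade1993 (4.2.4)); (iv) iterate over traversals for λ(k) → ∞ with
forced crossings near a, b and fjords a -/
@[route_item "route-CriticalPhenomena-SAWTargetMonotonicity", crux]
def MonotoneRSW : Prop :=
  TargetMonotone → DomainMonotone → ∀ (D : Literature.Probability.RandomPlanarGeometry.DobrushinDomain) (a b : ℝ → Literature.Probability.LatticeModels.Site 2), Literature.Probability.RandomPlanarGeometry.SAW.IsEndpointApprox D a b → ∃ (k : ℂ → ℝ → ℝ → ℕ) (K lam δ₀ : ℝ), 0 ≤ K ∧ 2 < lam ∧ 0 < δ₀ ∧ ∀ δ ∈ Set.Ioc (0 : ℝ) δ₀, ∀ (x : ℂ) (ρ R : ℝ), δ ≤ ρ → ρ < R → R ≤ 1 → Literature.Probability.RandomPlanarGeometry.SAW.law D.carrier δ (a δ) (b δ) {γ | (⟨γ.walk.toCurve (Literature.Probability.LatticeModels.meshPoint δ)⟩ : Literature.Probability.RandomPlanarGeometry.Curve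 ℂ).HasTraversals (k x ρ R) x ρ R} ≤ ENNReal.ofReal (K * (ρ / R) ^ lam)

/-- item stmt-CriticalPhenomena-0783 · crux · rank 5 · open · by planner
why it might fail: Unconditional over arbitrary subsequential μ: SLE_{8/3} is known only IF the limit is conformally covariant (LSW04 Prediction 1); on Z² no embedding-sensitive input exists; embedding-blind couplings cannot give rotations (Beffara2008).
sources: LawlerSchrammWerner2004SAW, LawlerSchrammWerner2003Restriction, DuminilCopinSmirnov2012, Beffara2008, stmt-CriticalPhenomena-0783
[crux] r3: identification of subsequential limits — for every Dobrushin domain D, endpoint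
approximation (a_δ,b_δ), sequence s_n → 0+ and probability measure μ on CurveClass ℂ, if ∫ f∘curve
d(Literature.Probability.RandomPlanarGeometry.SAW.law D (s n) …) → ∫ f dμ for all bounded continuous
f then μ is the chordal SLE_{8/3} law in D (Literature.Probability.RandomPlanarGeometry.IsSLELaw
(8/3) D μ). Obtained from r2 (observable limit) by the martingale principle (LSW03
arXiv:math/0209343 Prop. 5.2: κ = 8/3 is singled out by the 5/8-observable), or from restriction
(sibling route). -/
@[route_item "route-CriticalPhenomena-SAWTargetMonotonicity", crux]
def SubseqIdentification : Prop :=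
  ∀ (D : Literature.Probability.RandomPlanarGeometry.DobrushinDomain) (a b : ℝ → Literature.Probability.LatticeModels.Site 2), Literature.Probability.RandomPlanarGeometry.SAW.IsEndpointApprox D a b → ∀ (s : ℕ → ℝ) (μ : MeasureTheory.Measure (Literature.Probability.RandomPlanarGeometry.CurveClass ℂ)), Filter.Tendsto s Filter.atTop (nhdsWithin 0 (Set.Ioi 0)) → MeasureTheory.IsProbabilityMeasure μ → (∀ f : BoundedContinuousFunction (Literature.Probability.RandomPlanarGeometry.CurveClass ℂ) ℝ, Filter.Tendsto (fun n => ∫ γ, f γ.curve ∂(Literature.Probability.RandomPlanarGeometry.SAW.law D.carrier (s n) (a (s n)) (b (s n)))) Filter.atTop (nhds (∫ x, f x ∂μ))) → Literature.Probability.RandomPlanarGeometry.IsSLELaw ((8 : NNReal) / 3) D μ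

-- item stmt-CriticalPhenomena-8354 · support · rank 6 · open · by planner — informal only, no Lean statement yet:
--   [crux] ENDPOINT SQUEEZE (card U1′, the route's second deliverable; to be typed once definition
--   SAW.IsTargetOrdered lands). For every Dobrushin domain D = (Ω; a, b), source approximation a_δ and
--   BOUNDARY target approximation b_δ ∈ meshBoundary Ω δ (attached to the discrete boundary as in
--   TargetMonotone), assume: (i) TargetMonotone; (ii) for every target b′ ≠ b in a punctured
--   neighbourhood of b along ∂Ω (Dobrushin domains D′ with D′.toJordanDomain = D.toJordanDomain, D′.mark
--   0 = D.mark 0, 0 < |D′.mark 1 − D.mark 1| < ε) there is SOME target approximation b′_δ with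
--   IsEndpointApprox D′ a b′ along

/-- item stmt-CriticalPhenomena-1880 · support · rank 9 · open · by planner
sources: AizenmanBurchardDuke1999, KemppainenSmirnov2017, DuminilCopinHammond2013, arXiv:2310.17299, stmt-CriticalPhenomena-1880
[support] the Aizenman–Burchard hypothesis (H1) for the critical square-lattice SAW, standalone form
of r3's conclusion (so that other tightness routes — e.g. card saw-rsw-from-kesten-renewal-tightness
— can share it, and a direct proof by any method closes r3 too): for every Dobrushin domain D and
endpoint approximation (a_δ, b_δ) there exist a shell-dependent threshold k : ℂ → ℝ → ℝ → ℕ, K ≥ 0,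
λ > 2, δ₀ > 0 such that for δ ∈ (0, δ₀] and δ ≤ ρ < R ≤ 1,
Literature.Probability.RandomPlanarGeometry.SAW.law D δ a_δ b_δ {γ : the mesh polyline of γ has
k(x,ρ,R) separate traversals of D(x;ρ,R)} ≤ K(ρ/R)^λ
(Literature.Probability.RandomPlanarGeometry.Curve.HasTraversals). Shape copied from
Literature.Probability.Percolation.bondExploration_traversalBound (which is PROVED for percolation
in InterfaceTraversalBound.lean). -/
@[route_item "route-CriticalPhenomena-SAWTargetMonotonicity"]
def SAWTraversalBound : Prop :=
  ∀ (D : Literature.Probability.RandomPlanarGeometry.DobrushinDomain) (a b : ℝ → Literature.Probability.LatticeModels.Site 2), Literature.Probability.RandomPlanarGeometry.SAW.IsEndpointApprox D a b → ∃ (k : ℂ → ℝ → ℝ → ℕ) (K lam δ₀ : ℝ), 0 ≤ K ∧ 2 < lam ∧ 0 < δ₀ ∧ ∀ δ ∈ Set.Ioc (0 : ℝ) δ₀, ∀ (x : ℂ) (ρ R : ℝ), δ ≤ ρ → ρ < R → R ≤ 1 → Literature.Probability.RandomPlanarGeometry.SAW.law D.carrier δ (a δ) (b δ) {γ | (⟨γ.walk.toCurve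 (Literature.Probability.LatticeModels.meshPoint δ)⟩ : Literature.Probability.RandomPlanarGeometry.Curve ℂ).HasTraversals (k x ρ R) x ρ R} ≤ ENNReal.ofReal (K * (ρ / R) ^ lam)

/-- item stmt-CriticalPhenomena-1881 · support · rank 9 · open · by planner
sources: Summit.CriticalPhenomena.SAWScalingLimit.Theorems.SAWParafermionTight_refuted, AizenmanBurchardDuke1999, KemppainenSmirnov2017, stmt-CriticalPhenomena-1881
[support] EVENTUAL TIGHTNESS of the critical SAW laws: for every Dobrushin domain and endpoint
approximation, IsTightAlongMesh (fun δ γ => γ.curve) (fun δ => SAW.law D δ a_δ b_δ) — for every ε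
some compact set of CurveClass ℂ carries all but ε of the mass for all small δ. This is the form the
Prokhorov criterion convergesInLawToSLE_of_isTightAlongMesh consumes and the repair of the refuted
all-δ Tight (IsTightLaws over δ ∈ (0,1]) suggested by the refuting theorem; offered to routes
SAWParafermion / SAWConfRestriction as their restated r3/r4. -/
@[route_item "route-CriticalPhenomena-SAWTargetMonotonicity"]
def EventualTight : Prop :=
  ∀ (D : Literature.Probability.RandomPlanarGeometry.DobrushinDomain) (a b : ℝ → Literature.Probability.LatticeModels.Site 2), Literature.Probability.RandomPlanarGeometry.SAW.IsEndpointApprox D a b → Literature.Probability.RandomPlanarGeometry.IsTightAlongMesh (fun δ (γ : Literature.Probability.RandomPlanarGeometry.SAW.DomainSAW D.carrier δ (a δ) (b δ)) => γ.curve) (fun δ => Literature.Probability.RandomPlanarGeometry.SAW.law D.carrier δ (a δ) (b δ))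

/-- item stmt-CriticalPhenomena-1882 · support · rank 9 · closed · proved by Summit.CriticalPhenomena.SAWScalingLimit.Theorems.TraversalBoundTight_proof (prover) · by planner
sources: Literature.Probability.RandomPlanarGeometry.isTightMeasureSet_of_traversalBounds, Literature.Probability.RandomPlanarGeometry.isTightAlongMesh_of_isTightMeasureSet_image, AizenmanBurchardDuke1999, stmt-CriticalPhenomena-1882
[support] glue SAWTraversalBound → EventualTight by the tree's PROVED Aizenman–Burchard criterion
isTightMeasureSet_of_traversalBounds in E = ℂ with Λ = a closed ball containing D (d = 2,
exists_finset_card_le_cover_closedBall), T = Ioc 0 δ₀, X_δ γ = the mesh polyline of γ (whose class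
is γ.curve): (H0) short-distance cutoff — a SAW uses each lattice edge at most once and boundedly
many δ-edges meet closedBall x δ, so no shell of inner radius ≤ δ is traversed k₀ times (cf.
Percolation.bondExploration_shortDistanceCutoff); (H1) = SAWTraversalBound with threshold max k₀ (k
x ρ R); then isTightAlongMesh_of_isTightMeasureSet_image (a.e.-measurability is automatic, ⊤
σ-algebra: SAW.aemeasurable_curve). -/
@[route_item "route-CriticalPhenomena-SAWTargetMonotonicity", crux]
def TraversalBoundTight : Prop :=
  SAWTraversalBound → EventualTight

/-- `TraversalBoundTight` holds: proved by `Summit.CriticalPhenomena.SAWScalingLimit.Theorems.TraversalBoundTight_proof`. -/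
theorem TraversalBoundTight_holds : TraversalBoundTight := _root_.Summit.CriticalPhenomena.SAWScalingLimit.Theorems.TraversalBoundTight_proof

/-- item stmt-CriticalPhenomena-8256 · support · rank 9 · open · by planner
sources: FortuinKasteleynGinibre1971, Holley1974, Strassen1965, stmt-CriticalPhenomena-1877
[support] positive association implies domain monotonicity: the hypothesis is the body of
LeftRightFKG of route SAWLeftRightFKG (item stmt-CriticalPhenomena-1877) verbatim — w(A)w(B) ≤
w(univ)w(A∩B) for up-sets A, B of chords of Ω = {wind C ≠ 0} in the lens-winding order — and the
conclusion is DomainMonotone. Proof plan: law_{Ω′} = law_Ω(· | E) with E = {γ uses only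
vertices/edges of Ω′_δ} (same weights x_c^{|γ|}); E is a DOWN-set for the order (if γ₁ ≼ γ₂ and γ₂
avoids the removed set, so does γ₁ — planar argument with the winding regions); PA gives law(U ∩ E)
≤ law(U)·law(E) for every up-set U, hence law(U | E) ≤ law(U), and the up-closure of the image of A
is such a U; the ∩ D.carrier bites are handled by applying PA in Ω′-type winding domains or recorded
as a gap (the polygon case D ⊇ hull(C) is the core). [difficulty: M] -/
@[route_item "route-CriticalPhenomena-SAWTargetMonotonicity"]
def FKGGivesDomainMonotone : Prop :=
  (∀ (δ : ℝ) (c a b a' b' : Literature.Probability.LatticeModels.Site 2) (C : (Literature.Probability.LatticeModels.zdGraph 2).Walk c c), let Ω : Set ℂ := {z | Literature.Probability.RandomPlanarGeometry.Curve.wind ⟨C.toCurve (Literature.Probability.LatticeModels.meshPoint δ)⟩ z ≠ 0}; let le : Literature.Probability.RandomPlanarGeometry.SAW.DomainSAW Ω δ a b → Literature.Probability.RandomPlanarGeometry.SAW.DomainSAW Ω δ a b → Prop := fun γ₁ γ₂ => ∀ z : ℂ, 0 ≤ Literature.Probability.RandomPlanarGeometry.Curve.wind ⟨(γ₁.walk.append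 γ₂.walk.reverse).toCurve (Literature.Probability.LatticeModels.meshPoint δ)⟩ z; 0 < δ → a' ∈ C.support → b' ∈ C.support → (Literature.Probability.LatticeModels.zdGraph 2).Adj a a' → (Literature.Probability.LatticeModels.zdGraph 2).Adj b b' → ∀ A B : Set (Literature.Probability.RandomPlanarGeometry.SAW.DomainSAW Ω δ a b), (∀ γ₁ γ₂, le γ₁ γ₂ → γ₁ ∈ A → γ₂ ∈ A) → (∀ γ₁ γ₂, le γ₁ γ₂ → γ₁ ∈ B → γ₂ ∈ B) → Literature.Probability.RandomPlanarGeometry.SAW.weight Ω δ a b A * Literature.Probability.RandomPlanarGeometry.SAW.weight Ω δ a b B ≤ Literature.Probability.RandomPlanarGeometry.SAW.weight Ω δ a b Set.univ * Literature.Probability.RandomPlanarGeometry.SAW.weight Ω δ a b (A ∩ B)) → DomainMonotone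

/-- item stmt-CriticalPhenomena-8257 · assembly · rank 1 · closed · proved by Summit.CriticalPhenomena.SAWScalingLimit.Theorems.sawTargetMonotonicity_assembly_proof (prover) · by planner
sources: Literature.Probability.RandomPlanarGeometry.convergesInLawToSLE_of_isTightAlongMesh, Literature.Probability.RandomPlanarGeometry.IsSLECurve.map_eq_holds, BillingsleyCPM1999
[assembly] TargetMonotone → DomainMonotone → MonotoneRSW → TraversalBoundTight →
SubseqIdentification → SAWScalingLimit. -/
@[route_item "route-CriticalPhenomena-SAWTargetMonotonicity", crux]
def Assembly : Prop :=
  TargetMonotone → DomainMonotone → MonotoneRSW → TraversalBoundTight → SubseqIdentification → SAWScalingLimit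

-- `Assembly` holds: proved by `Summit.CriticalPhenomena.SAWScalingLimit.Theorems.sawTargetMonotonicity_assembly_proof` (its module imports this route file, so no `_holds` link can be stated here).

/-! D-0027 §2.1 — DECIDING THEOREM (planner-authored via `route open/edit --closes-file`; by planner-rbadge-CriticalPhenomena-SAWTargetMono-de0abef4-g4-0 2026-08-15T16:10:27Z):
its hypotheses are this route's items and its conclusion the sub-problem Statement (glue_lint), and it elaborates with this file. -/

@[closes "route-CriticalPhenomena-SAWTargetMonotonicity"] theorem closes : TargetMonotone → DomainMonotone → MonotoneRSW → TraversalBoundTight → SubseqIdentification → Assembly → _root_.SAWScalingLimit :=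
  fun hTM hDM hRSW hTBT hId hA => hA hTM hDM hRSW hTBT hId

end Summit.CriticalPhenomena.SAWScalingLimit.Theses.SAWTargetMonotonicity
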